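import Mathlib
import HarnessLib

/-!
# Three elementary inequalities for Selberg's mean-square argument

Topic `Literature/NumberTheory/LFunctions`. Everything here is PROVED (no definitions, no named
facts); these are the analytic devices by which the `t`-dependence of the abscissa
`σ_{x,t}` is removed in the mean square of Selberg's approximate formula for `S(t)`
(Selberg 1946, §§5–6; Titchmarsh §14.22 does this on RH where `σ_{x,t}` is constant):

* `Literature.NumberTheory.LFunctions.SelbergTools.le_sqrt_mul_of_forall` — the optimisation
  `(∀ λ > 0, X ≤ λℓ/2 + A/(2λ)) → X ≤ √(ℓA)` (Cauchy–Schwarz without `L²`);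
* `Literature.NumberTheory.LFunctions.SelbergTools.norm_sq_le_sobolev` — for `Q` with continuous
  derivative `Q'` on `[a, b]` and `σ ∈ [a, b]`: `‖Q σ‖² ≤ 2‖Q a‖² + 2(b−a) ∫_a^b ‖Q'‖²`;
* `Literature.NumberTheory.LFunctions.SelbergTools.integral_indicator_mul_sq_le` — Hölder on a set:
  `∫_a^b 1_S g² ≤ √(vol(S ∩ (a,b]) · ∫_a^b g⁴)` for measurable bounded `g ≥ 0`.

## References

* A. Selberg, *Contributions to the theory of the Riemann zeta-function* (1946), §§5–6.
* E. C. Titchmarsh, *The Theory of the Riemann Zeta-Function* (1986), §14.22. [cite: Titchmarsh1986, §14.22]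
-/

noncomputable section

open Real MeasureTheory Set intervalIntegral

namespace Literature.NumberTheory.LFunctions

namespace SelbergTools

/-- The optimisation behind Cauchy–Schwarz: if `X ≤ λℓ/2 + A/(2λ)` for every `λ > 0`
(`X, ℓ, A ≥ 0`), then `X ≤ √(ℓ A)`. [folklore] -/
theorem le_sqrt_mul_of_forall {X ℓ A : ℝ} (hX : 0 ≤ X) (hℓ : 0 ≤ ℓ) (hA : 0 ≤ A)
    (h : ∀ lam : ℝ, 0 < lam → X ≤ lam * ℓ / 2 + A / (2 * lam)) : X ≤ Real.sqrt (ℓ * A) := by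
  rcases hℓ.eq_or_lt with hℓ0 | hℓ0
  · -- `ℓ = 0`: `X ≤ A/(2λ)` for all `λ`, hence `X ≤ 0`
    rw [← hℓ0, zero_mul, Real.sqrt_zero]
    by_contra hX0
    push Not at hX0
    have h1 := h ((A + 1) / X) (by positivity)
    rw [← hℓ0, mul_zero, zero_div, zero_add] at h1
    have : A / (2 * ((A + 1) / X)) = A * X / (2 * (A + 1)) := by field_simp
    rw [this] at h1
    have h2 : A * X / (2 * (A + 1)) < X := by
      rw [div_lt_iff₀ (by positivity)]; nlinarith
    linarith
  rcases hA.eq_or_lt with hA0 | hA0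
  · -- `A = 0`: `X ≤ λℓ/2` for all `λ`, hence `X ≤ 0`
    rw [← hA0, mul_zero, Real.sqrt_zero]
    by_contra hX0
    push Not at hX0
    have h1 := h (X / ℓ) (by positivity)
    rw [← hA0, zero_div, add_zero, div_mul_cancel₀ _ hℓ0.ne'] at h1
    linarith
  · set lam := Real.sqrt (A / ℓ) with hlam
    have hlam0 : 0 < lam := Real.sqrt_pos.2 (by positivity)
    have h1 := h lam hlam0
    have hsq : lam ^ 2 = A / ℓ := Real.sq_sqrt (by positivity)
    have hprod : Real.sqrt (ℓ * A) = lam * ℓ := by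
      rw [hlam, ← Real.sqrt_sq hℓ0.le, ← Real.sqrt_mul (by positivity), Real.sqrt_sq hℓ0.le]
      congr 1; field_simp
    have e1 : A / (2 * lam) = lam * ℓ / 2 := by
      rw [div_eq_div_iff (by positivity) (by norm_num)]
      have : A = lam ^ 2 * ℓ := by rw [hsq, div_mul_cancel₀ _ hℓ0.ne']
      rw [this]; ring
    rw [e1] at h1
    rw [hprod]; linarith

/-- **Sobolev in the abscissa**: if `Q` has the continuous derivative `Q'` on `[a, b]` and
`σ ∈ [a, b]`, then `‖Q σ‖² ≤ 2‖Q a‖² + 2(b − a)∫_a^b ‖Q' u‖² du`. [folklore] -/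
theorem norm_sq_le_sobolev {Q Q' : ℝ → ℂ} {a b σ : ℝ} (hσ : σ ∈ Icc a b)
    (hderiv : ∀ u ∈ Icc a b, HasDerivAt Q (Q' u) u) (hcont : ContinuousOn Q' (Icc a b)) :
    ‖Q σ‖ ^ 2 ≤ 2 * ‖Q a‖ ^ 2 + 2 * (b - a) * ∫ u in a..b, ‖Q' u‖ ^ 2 := by
  have hab : a ≤ b := hσ.1.trans hσ.2
  have haσ : a ≤ σ := hσ.1
  -- FTC on `[a, σ]`
  have hcontσ : ContinuousOn Q' (uIcc a σ) := by
    rw [uIcc_of_le haσ]; exact hcont.mono (Icc_subset_Icc_right hσ.2)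
  have hint : IntervalIntegrable Q' volume a σ := hcontσ.intervalIntegrable
  have hftc : ∫ u in a..σ, Q' u = Q σ - Q a := by
    refine intervalIntegral.integral_eq_sub_of_hasDerivAt (fun u hu ↦ ?_) hint
    rw [uIcc_of_le haσ] at hu
    exact hderiv u ⟨hu.1, hu.2.trans hσ.2⟩
  -- `‖Q σ − Q a‖ ≤ ∫_a^b ‖Q'‖ ≤ λ(b−a)/2 + (∫‖Q'‖²)/(2λ)`
  have hcn : ContinuousOn (fun u ↦ ‖Q' u‖) (Icc a b) := continuous_norm.comp_continuousOn hcont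
  have hcn2 : ContinuousOn (fun u ↦ ‖Q' u‖ ^ 2) (Icc a b) := (continuous_pow 2).comp_continuousOn hcn
  have hIn : IntervalIntegrable (fun u ↦ ‖Q' u‖) volume a b := by
    refine ContinuousOn.intervalIntegrable ?_; rwa [uIcc_of_le hab]
  have hIn2 : IntervalIntegrable (fun u ↦ ‖Q' u‖ ^ 2) volume a b := by
    refine ContinuousOn.intervalIntegrable ?_; rwa [uIcc_of_le hab]
  set A := ∫ u in a..b, ‖Q' u‖ ^ 2 with hA
  have hA0 : 0 ≤ A := intervalIntegral.integral_nonneg hab fun u _ ↦ by positivity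
  have hX : ‖Q σ - Q a‖ ≤ ∫ u in a..b, ‖Q' u‖ := by
    rw [← hftc]
    refine (intervalIntegral.norm_integral_le_integral_norm haσ).trans ?_
    exact intervalIntegral.integral_mono_interval le_rfl haσ hσ.2
      (Filter.Eventually.of_forall fun u ↦ norm_nonneg _) hIn
  have hlam_all : ∀ lam : ℝ, 0 < lam → ‖Q σ - Q a‖ ≤ lam * (b - a) / 2 + A / (2 * lam) := by
    intro lam hlam
    refine hX.trans ?_
    have hpt : ∀ u ∈ Icc a b, ‖Q' u‖ ≤ lam / 2 + ‖Q' u‖ ^ 2 / (2 * lam) := by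
      intro u _
      have h0 : 0 ≤ (‖Q' u‖ - lam) ^ 2 := sq_nonneg _
      rw [div_add_div _ _ (by norm_num) (by positivity), le_div_iff₀ (by positivity)]
      nlinarith
    calc ∫ u in a..b, ‖Q' u‖ ≤ ∫ u in a..b, (lam / 2 + ‖Q' u‖ ^ 2 / (2 * lam)) :=
          intervalIntegral.integral_mono_on hab hIn (intervalIntegrable_const.add (hIn2.div_const _)) hpt
      _ = lam * (b - a) / 2 + A / (2 * lam) := by
          rw [intervalIntegral.integral_add intervalIntegrable_const (hIn2.div_const _),
            intervalIntegral.integral_const, smul_eq_mul, intervalIntegral.integral_div, ← hA]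
          ring
  have hCS := le_sqrt_mul_of_forall (norm_nonneg _) (by linarith) hA0 hlam_all
  -- conclude
  have h1 : ‖Q σ‖ ≤ ‖Q a‖ + ‖Q σ - Q a‖ := by
    have := norm_add_le (Q a) (Q σ - Q a); simpa using this
  have h2 : ‖Q σ - Q a‖ ^ 2 ≤ (b - a) * A := by
    have := pow_le_pow_left₀ (norm_nonneg _) hCS 2
    rwa [Real.sq_sqrt (by positivity)] at this
  have h3 : ‖Q σ‖ ^ 2 ≤ (‖Q a‖ + ‖Q σ - Q a‖) ^ 2 := pow_le_pow_left₀ (norm_nonneg _) h1 2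
  nlinarith [sq_nonneg (‖Q a‖ - ‖Q σ - Q a‖)]

/-- **Hölder on a set**: for a measurable set `S`, a measurable `g ≥ 0` bounded on `(a, b]`
(`a ≤ b`): `∫_a^b 1_S(t) g(t)² dt ≤ √( vol(S ∩ (a,b]) · ∫_a^b g(t)⁴ dt )`. [folklore] -/
theorem integral_indicator_mul_sq_le {S : Set ℝ} (hS : MeasurableSet S) {g : ℝ → ℝ} (hg : Measurable g)
    (hg0 : ∀ t, 0 ≤ g t) {M : ℝ} (hgM : ∀ t, g t ≤ M) {a b : ℝ} (hab : a ≤ b) :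
    ∫ t in a..b, S.indicator (fun t ↦ g t ^ 2) t ≤
      Real.sqrt ((volume (S ∩ Ioc a b)).toReal * ∫ t in a..b, g t ^ 4) := by
  have hfin : volume (Ioc a b) ≠ ⊤ := by rw [Real.volume_Ioc]; exact ENNReal.ofReal_ne_top
  have hM0 : 0 ≤ M := (hg0 a).trans (hgM a)
  -- integrability of everything in sight (bounded measurable on a finite interval)
  have hbint : ∀ {f : ℝ → ℝ}, Measurable f → (∀ t, ‖f t‖ ≤ M ^ 4 + M ^ 2 + 1) →
      IntervalIntegrable f volume a b := by
    intro f hf hb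
    rw [intervalIntegrable_iff_integrableOn_Ioc_of_le hab]
    exact Measure.integrableOn_of_bounded (M := M ^ 4 + M ^ 2 + 1) hfin hf.aestronglyMeasurable
      (ae_of_all _ hb)
  have hg2 : ∀ t, g t ^ 2 ≤ M ^ 2 := fun t ↦ pow_le_pow_left₀ (hg0 t) (hgM t) 2
  have hg4 : ∀ t, g t ^ 4 ≤ M ^ 4 := fun t ↦ pow_le_pow_left₀ (hg0 t) (hgM t) 4
  have hI1 : IntervalIntegrable (fun t ↦ S.indicator (fun t ↦ g t ^ 2) t) volume a b := by
    refine hbint ((hg.pow_const 2).indicator hS) fun t ↦ ?_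
    rw [Real.norm_eq_abs, abs_of_nonneg (Set.indicator_nonneg (fun _ _ ↦ by positivity) _)]
    refine (Set.indicator_le_self' (fun _ _ ↦ by positivity) t).trans ?_
    nlinarith [hg2 t, pow_nonneg hM0 4]
  have hIS : IntervalIntegrable (fun t ↦ S.indicator (fun _ ↦ (1 : ℝ)) t) volume a b := by
    refine hbint (measurable_const.indicator hS) fun t ↦ ?_
    rw [Real.norm_eq_abs, abs_of_nonneg (Set.indicator_nonneg (fun _ _ ↦ zero_le_one) _)]
    refine (Set.indicator_le_self' (fun _ _ ↦ zero_le_one) t).trans ?_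
    nlinarith [pow_nonneg hM0 4, pow_nonneg hM0 2]
  have hI4 : IntervalIntegrable (fun t ↦ g t ^ 4) volume a b := by
    refine hbint (hg.pow_const 4) fun t ↦ ?_
    rw [Real.norm_eq_abs, abs_of_nonneg (by positivity)]
    nlinarith [hg4 t, pow_nonneg hM0 2]
  set V := (volume (S ∩ Ioc a b)).toReal with hV
  set A := ∫ t in a..b, g t ^ 4 with hA
  have hV0 : 0 ≤ V := ENNReal.toReal_nonneg
  have hA0 : 0 ≤ A := intervalIntegral.integral_nonneg hab fun t _ ↦ by positivity
  have hX0 : 0 ≤ ∫ t in a..b, S.indicator (fun t ↦ g t ^ 2) t :=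
    intervalIntegral.integral_nonneg hab fun t _ ↦ Set.indicator_nonneg (fun _ _ ↦ by positivity) _
  -- `∫ 1_S = V`
  have hvolS : ∫ t in a..b, S.indicator (fun _ ↦ (1 : ℝ)) t = V := by
    rw [intervalIntegral.integral_of_le hab, integral_indicator_const _ hS, smul_eq_mul, mul_one,
      measureReal_def, Measure.restrict_apply hS, hV]
  refine le_sqrt_mul_of_forall hX0 hV0 hA0 fun lam hlam ↦ ?_
  -- pointwise: `1_S g² ≤ λ 1_S/2 + g⁴/(2λ)`
  have hpt : ∀ t ∈ Icc a b, S.indicator (fun t ↦ g t ^ 2) t ≤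
      lam / 2 * S.indicator (fun _ ↦ (1 : ℝ)) t + g t ^ 4 / (2 * lam) := by
    intro t _
    by_cases ht : t ∈ S
    · rw [Set.indicator_of_mem ht, Set.indicator_of_mem ht, mul_one]
      have h0 : 0 ≤ (g t ^ 2 - lam) ^ 2 := sq_nonneg _
      rw [div_add_div _ _ (by norm_num) (by positivity), le_div_iff₀ (by positivity)]
      nlinarith
    · rw [Set.indicator_of_notMem ht, Set.indicator_of_notMem ht, mul_zero, zero_add]
      positivity
  calc ∫ t in a..b, S.indicator (fun t ↦ g t ^ 2) t
      ≤ ∫ t in a..b, (lam / 2 * S.indicator (fun _ ↦ (1 : ℝ)) t + g t ^ 4 / (2 * lam)) :=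
        intervalIntegral.integral_mono_on hab hI1 ((hIS.const_mul _).add (hI4.div_const _)) hpt
    _ = lam * V / 2 + A / (2 * lam) := by
        rw [intervalIntegral.integral_add (hIS.const_mul _) (hI4.div_const _),
          intervalIntegral.integral_const_mul, hvolS, intervalIntegral.integral_div, ← hA]
        ring

end SelbergTools

end Literature.NumberTheory.LFunctions
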